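import Mathlib
import Summits.Ventures.Crystal3D.Theorems.StickyWulffConstantTextureLiminfTentCells
import Summits.Ventures.Crystal3D.Theorems.StickyWulffConstantTextureLiminfTentTablesBridge
import Literature.Analysis.Convexity.SimplexSlices
import HarnessLib

/-!
# The tent certificate for fcc grains — the three kinds of cells: vertices and simplex containment (eng g8)

Route `StickyWulffConstant` (`Summits/Ventures/Crystal3D`, cell `crystal3d-full`), support toward the crux
`TextureLiminf` (stmt-Ventures-19483), FREE half (tent certificate, TexShadow v6.1).  For the labels
`labelUp p`, `labelDn p`, `labelCorner p s` of `…TentHatDefs.lean`: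
* `mem_closedChamber_intVec` — membership of a `D₃/√2` point in a closed chamber is an integer condition;
* the VERTICES `site (p + tetUpV j)`, `site (p + tetDnV j)`, `centre p` / `site (p + octV (octIdx a (s a)))`
  lie in the closed chamber of their cell (`site_tetUpV_mem_closedChamber`, …);
* `closedChamber ⊆ rogersSimplex` (the `H ⊆ V` direction, explicit barycentric coordinates:
  `closedChamber_labelUp_subset_rogersSimplex`, `…labelDn…`, `…labelCorner…`) — hence the volume bounds
  `volume (cellOf (labelUp p)) ≤ 1/(6√2)` etc. via `volume_tetUp` / `volume_corner`, and an affine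
  function on a closed chamber is the barycentric combination of its vertex values
  (`affine_eq_of_vertices_tet`, `affine_eq_of_vertices_corner`).
WHAT THIS IS NOT: the classification of nonempty chambers / the certificate; F-C1 not moved.
-/

noncomputable section

namespace Summit.Ventures.Crystal3D.TentCertificate

open Finset Summit.Ventures.Crystal3D MeasureTheory
open Literature.Geometry.DiscreteGeometry (intVec intVec_apply)
open Literature.Barriers.AtomisticToContinuum (rogersSimplex)
open Literature.Analysis.Convexity (mem_rogersSimplex_iff)
open scoped RealInnerProductSpace

/-! ## Integer membership test -/

/-- `⟪intVec a, intVec Z⟫ = Σ a_l Z_l` (an integer). -/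
theorem inner_intVec_intVec (a Z : Site) :
    ⟪intVec a, intVec Z⟫ = ((a 0 * Z 0 + a 1 * Z 1 + a 2 * Z 2 : ℤ) : ℝ) := by
  rw [inner_intVec_left]; simp [intVec_apply]

/-- `√2 • ((√2)⁻¹ • v) = v`. -/
theorem sqrt2_smul_inv_smul (v : EuclideanSpace ℝ (Fin 3)) :
    Real.sqrt 2 • ((Real.sqrt 2)⁻¹ • v) = v := by
  rw [smul_smul, mul_inv_cancel₀ (by positivity), one_smul]

/-- **Membership of a `D₃/√2` point in a closed chamber is an integer condition.** -/
theorem mem_closedChamber_intVec (k : Fin 3 → ℤ) (m : Fin 4 → ℤ) (Z : Site) :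
    (Real.sqrt 2)⁻¹ • intVec Z ∈ closedChamber k m ↔
      (∀ i : Fin 3, k i ≤ Z i ∧ Z i ≤ k i + 1) ∧
      (∀ j : Fin 4, 2 * m j ≤ normal4 j 0 * Z 0 + normal4 j 1 * Z 1 + normal4 j 2 * Z 2 ∧
        normal4 j 0 * Z 0 + normal4 j 1 * Z 1 + normal4 j 2 * Z 2 ≤ 2 * m j + 2) := by
  have hc : ∀ i : Fin 3, Real.sqrt 2 * (((Real.sqrt 2)⁻¹ • intVec Z) : EuclideanSpace ℝ (Fin 3)) i = Z i := by
    intro i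
    simp only [PiLp.smul_apply, smul_eq_mul, intVec_apply]
    rw [← mul_assoc, mul_inv_cancel₀ (by positivity), one_mul]
  simp only [closedChamber, Set.mem_setOf_eq, hc, sqrt2_smul_inv_smul, inner_intVec_intVec]
  constructor
  · rintro ⟨h1, h2⟩
    refine ⟨fun i => ⟨?_, ?_⟩, fun j => ⟨?_, ?_⟩⟩
    · exact_mod_cast (h1 i).1
    · exact_mod_cast (h1 i).2
    · exact_mod_cast (h2 j).1
    · exact_mod_cast (h2 j).2
  · rintro ⟨h1, h2⟩
    refine ⟨fun i => ⟨?_, ?_⟩, fun j => ⟨?_, ?_⟩⟩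
    · exact_mod_cast (h1 i).1
    · exact_mod_cast (h1 i).2
    · exact_mod_cast (h2 j).1
    · exact_mod_cast (h2 j).2

/-- `site q = (√2)⁻¹ • intVec (fccPoint q)` (definitional, restated). -/
theorem site_eq (q : Site) : site q = (Real.sqrt 2)⁻¹ • intVec (fccPoint q) := rfl

/-- `centre p = (√2)⁻¹ • intVec (holeZ p)`. -/
theorem centre_eq (p : Site) : centre p = (Real.sqrt 2)⁻¹ • intVec (holeZ p) := by
  rw [centre, site, holeZ, intVec_add, smul_add]

/-- Coordinates of `fccPoint`. -/
theorem fccPoint_apply (p : Site) :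
    fccPoint p 0 = p 0 + p 1 ∧ fccPoint p 1 = p 0 + p 2 ∧ fccPoint p 2 = p 1 + p 2 := ⟨rfl, rfl, rfl⟩

/-- Coordinates of `holeZ`. -/
theorem holeZ_apply (p : Site) :
    holeZ p 0 = p 0 + p 1 + 1 ∧ holeZ p 1 = p 0 + p 2 ∧ holeZ p 2 = p 1 + p 2 := by
  refine ⟨?_, ?_, ?_⟩ <;> simp [holeZ, fccPoint]

/-- `⟪a_j, fccPoint p⟫ = 2 (labelUp p)_j` over `ℤ`. -/
theorem normal4_dot_fccPoint (p : Site) (j : Fin 4) :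
    normal4 j 0 * fccPoint p 0 + normal4 j 1 * fccPoint p 1 + normal4 j 2 * fccPoint p 2 =
      2 * (labelUp p).2 j := by
  obtain ⟨h0, h1, h2⟩ := fccPoint_apply p
  rw [h0, h1, h2]
  fin_cases j <;> simp [normal4, labelUp] <;> ring

/-- `⟪a_j, holeZ p⟫ = 2 (labelCorner p s)_j + 1` over `ℤ` (independent of `s`). -/
theorem normal4_dot_holeZ (p : Site) (s : Fin 3 → Bool) (j : Fin 4) :
    normal4 j 0 * holeZ p 0 + normal4 j 1 * holeZ p 1 + normal4 j 2 * holeZ p 2 =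
      2 * (labelCorner p s).2 j + 1 := by
  obtain ⟨h0, h1, h2⟩ := holeZ_apply p
  rw [h0, h1, h2]
  fin_cases j <;> simp [normal4, labelCorner] <;> ring

/-! ## Vertices lie in the closed chambers -/

/-- Reduced membership test for the chamber of `T⁺(p)`: a point `fccPoint p + v`. -/
theorem mem_closedChamber_labelUp_iff (p v : Site) :
    (Real.sqrt 2)⁻¹ • intVec (fccPoint p + v) ∈ closedChamber (labelUp p).1 (labelUp p).2 ↔
      (∀ i : Fin 3, 0 ≤ v i ∧ v i ≤ 1) ∧
      (∀ j : Fin 4, 0 ≤ normal4 j 0 * v 0 + normal4 j 1 * v 1 + normal4 j 2 * v 2 ∧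
        normal4 j 0 * v 0 + normal4 j 1 * v 1 + normal4 j 2 * v 2 ≤ 2) := by
  rw [mem_closedChamber_intVec]
  have hk : (labelUp p).1 = fccPoint p := rfl
  simp only [hk, Pi.add_apply]
  constructor
  · rintro ⟨h1, h2⟩
    refine ⟨fun i => ⟨by linarith [(h1 i).1], by linarith [(h1 i).2]⟩, fun j => ⟨?_, ?_⟩⟩
    · have := (h2 j).1; have e := normal4_dot_fccPoint p j; nlinarith
    · have := (h2 j).2; have e := normal4_dot_fccPoint p j; nlinarith
  · rintro ⟨h1, h2⟩
    refine ⟨fun i => ⟨by linarith [(h1 i).1], by linarith [(h1 i).2]⟩, fun j => ⟨?_, ?_⟩⟩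
    · have := (h2 j).1; have e := normal4_dot_fccPoint p j; nlinarith
    · have := (h2 j).2; have e := normal4_dot_fccPoint p j; nlinarith

/-- Reduced membership test for the chamber of `T⁻(p)`: a point `fccPoint p + v`. -/
theorem mem_closedChamber_labelDn_iff (p v : Site) :
    (Real.sqrt 2)⁻¹ • intVec (fccPoint p + v) ∈ closedChamber (labelDn p).1 (labelDn p).2 ↔
      (∀ i : Fin 3, -1 ≤ v i ∧ v i ≤ 0) ∧
      (∀ j : Fin 4, -2 ≤ normal4 j 0 * v 0 + normal4 j 1 * v 1 + normal4 j 2 * v 2 ∧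
        normal4 j 0 * v 0 + normal4 j 1 * v 1 + normal4 j 2 * v 2 ≤ 0) := by
  rw [mem_closedChamber_intVec]
  have hk : ∀ i, (labelDn p).1 i = fccPoint p i - 1 := by
    intro i; fin_cases i <;> rfl
  have hm : ∀ j, (labelDn p).2 j = (labelUp p).2 j - 1 := by
    intro j; fin_cases j <;> rfl
  simp only [hk, hm, Pi.add_apply]
  constructor
  · rintro ⟨h1, h2⟩
    refine ⟨fun i => ⟨by linarith [(h1 i).1], by linarith [(h1 i).2]⟩, fun j => ⟨?_, ?_⟩⟩
    · have := (h2 j).1; have e := normal4_dot_fccPoint p j; nlinarith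
    · have := (h2 j).2; have e := normal4_dot_fccPoint p j; nlinarith
  · rintro ⟨h1, h2⟩
    refine ⟨fun i => ⟨by linarith [(h1 i).1], by linarith [(h1 i).2]⟩, fun j => ⟨?_, ?_⟩⟩
    · have := (h2 j).1; have e := normal4_dot_fccPoint p j; nlinarith
    · have := (h2 j).2; have e := normal4_dot_fccPoint p j; nlinarith

/-- Reduced membership test for the chamber of the corner `(p, s)`: a point `holeZ p + u`. -/
theorem mem_closedChamber_labelCorner_iff (p : Site) (s : Fin 3 → Bool) (u : Site) :
    (Real.sqrt 2)⁻¹ • intVec (holeZ p + u) ∈ closedChamber (labelCorner p s).1 (labelCorner p s).2 ↔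
      (∀ i : Fin 3, -(if s i then (0 : ℤ) else 1) ≤ u i ∧ u i ≤ 1 - (if s i then (0 : ℤ) else 1)) ∧
      (∀ j : Fin 4, -1 ≤ normal4 j 0 * u 0 + normal4 j 1 * u 1 + normal4 j 2 * u 2 ∧
        normal4 j 0 * u 0 + normal4 j 1 * u 1 + normal4 j 2 * u 2 ≤ 1) := by
  rw [mem_closedChamber_intVec]
  have hk : ∀ i, (labelCorner p s).1 i = holeZ p i - (if s i then (0 : ℤ) else 1) := fun i => rfl
  simp only [hk, Pi.add_apply]
  constructor
  · rintro ⟨h1, h2⟩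
    refine ⟨fun i => ⟨by linarith [(h1 i).1], by linarith [(h1 i).2]⟩, fun j => ⟨?_, ?_⟩⟩
    · have := (h2 j).1; have e := normal4_dot_holeZ p s j; nlinarith
    · have := (h2 j).2; have e := normal4_dot_holeZ p s j; nlinarith
  · rintro ⟨h1, h2⟩
    refine ⟨fun i => ⟨by linarith [(h1 i).1], by linarith [(h1 i).2]⟩, fun j => ⟨?_, ?_⟩⟩
    · have := (h2 j).1; have e := normal4_dot_holeZ p s j; nlinarith
    · have := (h2 j).2; have e := normal4_dot_holeZ p s j; nlinarith

/-- The vertices of `T⁺(p)` lie in the closed chamber `labelUp p`. -/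
theorem site_tetUpV_mem_closedChamber (p : Site) (j : Fin 4) :
    site (p + tetUpV j) ∈ closedChamber (labelUp p).1 (labelUp p).2 := by
  rw [site_eq, fccPoint_add, mem_closedChamber_labelUp_iff]
  fin_cases j <;> decide

/-- The vertices of `T⁻(p)` lie in the closed chamber `labelDn p`. -/
theorem site_tetDnV_mem_closedChamber (p : Site) (j : Fin 4) :
    site (p + tetDnV j) ∈ closedChamber (labelDn p).1 (labelDn p).2 := by
  rw [site_eq, fccPoint_add, mem_closedChamber_labelDn_iff]
  fin_cases j <;> decide

/-- The apex of a corner lies in its closed chamber. -/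
theorem centre_mem_closedChamber (p : Site) (s : Fin 3 → Bool) :
    centre p ∈ closedChamber (labelCorner p s).1 (labelCorner p s).2 := by
  have h : centre p = (Real.sqrt 2)⁻¹ • intVec (holeZ p + 0) := by rw [add_zero]; exact centre_eq p
  rw [h, mem_closedChamber_labelCorner_iff]
  refine ⟨fun i => ?_, fun j => ?_⟩
  · rcases Bool.eq_false_or_eq_true (s i) with h | h <;> simp [h]
  · fin_cases j <;> simp [normal4]

/-- The axis-`a` vertex offset of the octahedron from its centre: `fccPoint (octV (octIdx a b)) = (1,0,0) ± e_a`. -/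
theorem fccPoint_octV_octIdx (a : Fin 3) (b : Bool) (i : Fin 3) :
    fccPoint (octV (octIdx a b)) i = (![1, 0, 0] : Site) i + (if i = a then (if b then 1 else -1) else 0) := by
  fin_cases a <;> cases b <;> fin_cases i <;> decide

/-- The base vertices of a corner lie in its closed chamber. -/
theorem site_octV_mem_closedChamber (p : Site) (s : Fin 3 → Bool) (a : Fin 3) :
    site (p + octV (octIdx a (s a))) ∈ closedChamber (labelCorner p s).1 (labelCorner p s).2 := by
  set u : Site := fun i => if i = a then (if s a then 1 else -1) else 0 with hu
  have hZ : fccPoint (p + octV (octIdx a (s a))) = holeZ p + u := by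
    funext i
    rw [fccPoint_add, Pi.add_apply, fccPoint_octV_octIdx, holeZ, Pi.add_apply, Pi.add_apply, hu]
    ring
  rw [site_eq, hZ, mem_closedChamber_labelCorner_iff]
  refine ⟨fun i => ?_, fun j => ?_⟩
  · by_cases hia : i = a
    · subst hia
      rcases Bool.eq_false_or_eq_true (s i) with h | h <;> simp [hu, h]
    · rcases Bool.eq_false_or_eq_true (s i) with h | h <;> simp [hu, hia, h]
  · have key : normal4 j 0 * u 0 + normal4 j 1 * u 1 + normal4 j 2 * u 2 =
        (if s a then 1 else -1) * normal4 j a := by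
      fin_cases a <;> simp [hu]
    have hn : normal4 j a = 1 ∨ normal4 j a = -1 := by
      fin_cases j <;> fin_cases a <;> simp [normal4]
    rw [key]
    rcases Bool.eq_false_or_eq_true (s a) with h | h <;> rcases hn with hn | hn <;> simp [h, hn]

/-! ## `H ⊆ V`: closed chambers lie in the simplices spanned by their vertices -/

/-- Coordinates of `site q`. -/
theorem site_apply (q : Site) (l : Fin 3) : site q l = (Real.sqrt 2)⁻¹ * (fccPoint q l : ℝ) := by
  simp [site, intVec_apply]

/-- **Barycentric coordinates on the closed chamber of `T⁺(p)`**: every point is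
`site p + Σ tᵢ (site (p + tetUpV ᵢ₊₁) − site p)` with `tᵢ ≥ 0`, `Σ tᵢ ≤ 1`. -/
theorem exists_barycentric_labelUp (p : Site) {x : EuclideanSpace ℝ (Fin 3)}
    (hx : x ∈ closedChamber (labelUp p).1 (labelUp p).2) :
    ∃ t₀ t₁ t₂ : ℝ, 0 ≤ t₀ ∧ 0 ≤ t₁ ∧ 0 ≤ t₂ ∧ t₀ + t₁ + t₂ ≤ 1 ∧
      x = site p + t₀ • (site (p + tetUpV 1) - site p) + t₁ • (site (p + tetUpV 2) - site p) +
        t₂ • (site (p + tetUpV 3) - site p) := by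
  obtain ⟨hk, hm⟩ := hx
  have hk' : ∀ i, (fccPoint p i : ℝ) ≤ Real.sqrt 2 * x i ∧ Real.sqrt 2 * x i ≤ fccPoint p i + 1 := hk
  have hm0 := hm 0; have hm1 := hm 1; have hm2 := hm 2; have hm3 := hm 3
  simp only [inner_intVec_left, PiLp.smul_apply, smul_eq_mul, labelUp, normal4] at hm0 hm1 hm2 hm3
  simp only [Matrix.cons_val_zero, Matrix.cons_val_one, Matrix.cons_val, Int.cast_add,
    Int.cast_one, Int.cast_neg] at hm0 hm1 hm2 hm3
  obtain ⟨e0, e1, e2⟩ := fccPoint_apply p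
  have hs : (0 : ℝ) < Real.sqrt 2 := by positivity
  -- the offsets `u_l = √2 x_l − P_l`
  set u0 : ℝ := Real.sqrt 2 * x 0 - fccPoint p 0 with hu0
  set u1 : ℝ := Real.sqrt 2 * x 1 - fccPoint p 1 with hu1
  set u2 : ℝ := Real.sqrt 2 * x 2 - fccPoint p 2 with hu2
  have c0 : (fccPoint p 0 : ℝ) = p 0 + p 1 := by rw [e0]; push_cast; ring
  have c1 : (fccPoint p 1 : ℝ) = p 0 + p 2 := by rw [e1]; push_cast; ring
  have c2 : (fccPoint p 2 : ℝ) = p 1 + p 2 := by rw [e2]; push_cast; ring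
  refine ⟨(u0 + u1 - u2) / 2, (u0 - u1 + u2) / 2, (-u0 + u1 + u2) / 2, ?_, ?_, ?_, ?_, ?_⟩
  · rw [hu0, hu1, hu2]; nlinarith [hm1.1, c0, c1, c2]
  · rw [hu0, hu1, hu2]; nlinarith [hm2.1, c0, c1, c2]
  · rw [hu0, hu1, hu2]; nlinarith [hm3.1, c0, c1, c2]
  · rw [hu0, hu1, hu2]; nlinarith [hm0.2, c0, c1, c2]
  · ext l
    simp only [PiLp.add_apply, PiLp.smul_apply, PiLp.sub_apply, smul_eq_mul, site_apply, fccPoint_add,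
      Pi.add_apply, Int.cast_add]
    fin_cases l <;> simp [tetUpV, fccPoint] <;> field_simp <;> rw [hu0, hu1, hu2] <;> linarith [c0, c1, c2]

/-- **Barycentric coordinates on the closed chamber of `T⁻(p)`.** -/
theorem exists_barycentric_labelDn (p : Site) {x : EuclideanSpace ℝ (Fin 3)}
    (hx : x ∈ closedChamber (labelDn p).1 (labelDn p).2) :
    ∃ t₀ t₁ t₂ : ℝ, 0 ≤ t₀ ∧ 0 ≤ t₁ ∧ 0 ≤ t₂ ∧ t₀ + t₁ + t₂ ≤ 1 ∧
      x = site p + t₀ • (site (p + tetDnV 1) - site p) + t₁ • (site (p + tetDnV 2) - site p) +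
        t₂ • (site (p + tetDnV 3) - site p) := by
  obtain ⟨hk, hm⟩ := hx
  have hkd : ∀ i, (labelDn p).1 i = fccPoint p i - 1 := by intro i; fin_cases i <;> rfl
  have hk' : ∀ i, ((fccPoint p i - 1 : ℤ) : ℝ) ≤ Real.sqrt 2 * x i ∧ Real.sqrt 2 * x i ≤ ((fccPoint p i - 1 : ℤ) : ℝ) + 1 := by
    intro i; rw [← hkd]; exact hk i
  have hm0 := hm 0; have hm1 := hm 1; have hm2 := hm 2; have hm3 := hm 3
  simp only [inner_intVec_left, PiLp.smul_apply, smul_eq_mul, labelDn, normal4] at hm0 hm1 hm2 hm3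
  simp only [Matrix.cons_val_zero, Matrix.cons_val_one, Matrix.cons_val, Int.cast_add, Int.cast_sub,
    Int.cast_one, Int.cast_neg] at hm0 hm1 hm2 hm3
  obtain ⟨e0, e1, e2⟩ := fccPoint_apply p
  have hs : (0 : ℝ) < Real.sqrt 2 := by positivity
  have hk0 := hk' 0; have hk1 := hk' 1; have hk2 := hk' 2
  push_cast at hk0 hk1 hk2
  set u0 : ℝ := Real.sqrt 2 * x 0 - fccPoint p 0 with hu0
  set u1 : ℝ := Real.sqrt 2 * x 1 - fccPoint p 1 with hu1
  set u2 : ℝ := Real.sqrt 2 * x 2 - fccPoint p 2 with hu2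
  have c0 : (fccPoint p 0 : ℝ) = p 0 + p 1 := by rw [e0]; push_cast; ring
  have c1 : (fccPoint p 1 : ℝ) = p 0 + p 2 := by rw [e1]; push_cast; ring
  have c2 : (fccPoint p 2 : ℝ) = p 1 + p 2 := by rw [e2]; push_cast; ring
  refine ⟨-(u0 + u1 - u2) / 2, -(u0 - u1 + u2) / 2, -(-u0 + u1 + u2) / 2, ?_, ?_, ?_, ?_, ?_⟩
  · rw [hu0, hu1, hu2]; nlinarith [hm1.2, c0, c1, c2]
  · rw [hu0, hu1, hu2]; nlinarith [hm2.2, c0, c1, c2]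
  · rw [hu0, hu1, hu2]; nlinarith [hm3.2, c0, c1, c2]
  · rw [hu0, hu1, hu2]; nlinarith [hm0.1, c0, c1, c2]
  · ext l
    simp only [PiLp.add_apply, PiLp.smul_apply, PiLp.sub_apply, smul_eq_mul, site_apply, fccPoint_add,
      Pi.add_apply, Int.cast_add]
    fin_cases l <;> simp [tetDnV, fccPoint] <;> field_simp <;> rw [hu0, hu1, hu2] <;> linarith [c0, c1, c2]

/-- **Barycentric coordinates on the closed chamber of the corner `(p, s)`** (apex `centre p`, edges to the
chosen octahedron vertices). -/
theorem exists_barycentric_labelCorner (p : Site) (s : Fin 3 → Bool) {x : EuclideanSpace ℝ (Fin 3)}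
    (hx : x ∈ closedChamber (labelCorner p s).1 (labelCorner p s).2) :
    ∃ t₀ t₁ t₂ : ℝ, 0 ≤ t₀ ∧ 0 ≤ t₁ ∧ 0 ≤ t₂ ∧ t₀ + t₁ + t₂ ≤ 1 ∧
      x = centre p + t₀ • (site (p + octV (octIdx 0 (s 0))) - centre p) +
        t₁ • (site (p + octV (octIdx 1 (s 1))) - centre p) +
        t₂ • (site (p + octV (octIdx 2 (s 2))) - centre p) := by
  obtain ⟨hk, hm⟩ := hx
  have hkd : ∀ i, (labelCorner p s).1 i = holeZ p i - (if s i then (0 : ℤ) else 1) := fun i => rfl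
  obtain ⟨e0, e1, e2⟩ := holeZ_apply p
  have hs2 : (0 : ℝ) < Real.sqrt 2 := by positivity
  -- offsets from the hole, with their signs
  set u : Fin 3 → ℝ := fun i => Real.sqrt 2 * x i - holeZ p i with hu
  have hbox : ∀ i, 0 ≤ sgnR (s i) * u i ∧ sgnR (s i) * u i ≤ 1 := by
    intro i
    have h := hk i
    rw [hkd] at h
    rcases Bool.eq_false_or_eq_true (s i) with hsi | hsi
    · simp only [hsi] at h; push_cast at h
      simp only [hu, hsi, sgnR]; constructor <;> simp <;> linarith [h.1, h.2]
    · simp only [hsi] at h; push_cast at h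
      simp only [hu, hsi, sgnR]; constructor <;> simp <;> linarith [h.1, h.2]
  -- the sum `Σ σ_i u_i ≤ 1` from the `(111)` window of the family `±σ`
  have hsgn1 : ∀ i, sgnR (s i) = 1 ∨ sgnR (s i) = -1 := by
    intro i; rcases Bool.eq_false_or_eq_true (s i) with h | h <;> simp [sgnR, h]
  obtain ⟨j, ε, hε, hσ⟩ := exists_normal4_of_signs (fun i => sgnR (s i)) hsgn1
  have hwin := hm j
  rw [inner_intVec_left] at hwin
  simp only [PiLp.smul_apply, smul_eq_mul] at hwin
  have hdot := normal4_dot_holeZ p s j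
  have hdotR : (normal4 j 0 : ℝ) * holeZ p 0 + (normal4 j 1 : ℝ) * holeZ p 1 + (normal4 j 2 : ℝ) * holeZ p 2 =
      2 * ((labelCorner p s).2 j : ℝ) + 1 := by exact_mod_cast hdot
  have hsum : sgnR (s 0) * u 0 + sgnR (s 1) * u 1 + sgnR (s 2) * u 2 ≤ 1 := by
    rw [hσ 0, hσ 1, hσ 2]
    simp only [hu]
    rcases hε with rfl | rfl
    · nlinarith [hwin.2, hdotR]
    · nlinarith [hwin.1, hdotR]
  refine ⟨sgnR (s 0) * u 0, sgnR (s 1) * u 1, sgnR (s 2) * u 2, (hbox 0).1, (hbox 1).1, (hbox 2).1,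
    hsum, ?_⟩
  rw [site_octV, site_octV, site_octV]
  simp only [add_sub_cancel_left, smul_smul]
  ext l
  rw [centre_eq]
  simp only [PiLp.add_apply, PiLp.smul_apply, smul_eq_mul, intVec_apply, PiLp.single_apply]
  fin_cases l
  · rcases Bool.eq_false_or_eq_true (s 0) with h | h <;> simp [hu, h, sgnR] <;> field_simp <;> ring
  · rcases Bool.eq_false_or_eq_true (s 1) with h | h <;> simp [hu, h, sgnR] <;> field_simp <;> ring
  · rcases Bool.eq_false_or_eq_true (s 2) with h | h <;> simp [hu, h, sgnR] <;> field_simp <;> ring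

/-- An affine function along barycentric coordinates. -/
theorem affine_barycentric (g v₀ v₁ v₂ v₃ : EuclideanSpace ℝ (Fin 3)) (b t₀ t₁ t₂ : ℝ) :
    ⟪g, v₀ + t₀ • (v₁ - v₀) + t₁ • (v₂ - v₀) + t₂ • (v₃ - v₀)⟫ + b =
      (1 - t₀ - t₁ - t₂) * (⟪g, v₀⟫ + b) + t₀ * (⟪g, v₁⟫ + b) + t₁ * (⟪g, v₂⟫ + b) +
        t₂ * (⟪g, v₃⟫ + b) := by
  simp only [inner_add_right, inner_smul_right, inner_sub_right]; ring

end Summit.Ventures.Crystal3D.TentCertificate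

end
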